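import Summits.BirchSwinnertonDyer.BirchSwinnertonDyer.Theorems.GenusKolyvaginAtTwoShaCardDvdPowAtTwoRTSandwichAssembly
import Summits.BirchSwinnertonDyer.BirchSwinnertonDyer.Theorems.GenusKolyvaginAtTwoShaCardDvdPowAtTwoRTShaFiniteAtTwoTwinShaTrivial
import Summits.BirchSwinnertonDyer.BirchSwinnertonDyer.Theorems.GenusKolyvaginAtTwoShaCardDvdPowAtTwoRTShaFiniteAtTwoRat
import Summits.BirchSwinnertonDyer.BirchSwinnertonDyer.Theorems.GenusKolyvaginAtTwoShaCardDvdPowAtTwoRTRelaxedIndexSha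
import Summits.BirchSwinnertonDyer.BirchSwinnertonDyer.Theorems.GenusKolyvaginAtTwoPowDvdShaCardAtTwoRTLadderFrame
import Summits.BirchSwinnertonDyer.BirchSwinnertonDyer.Theorems.GenusKolyvaginAtTwoPowDvdShaCardAtTwoRTGenusKernelHabitat
import Summits.BirchSwinnertonDyer.BirchSwinnertonDyer.Theorems.SylvesterTwoHeegnerIndexShaConjugation
import Literature.NumberTheory.EllipticCurves.QuadraticTwistSelmerPInfty
import Literature.NumberTheory.EllipticCurves.SelmerTorsionTwistRestriction
import Literature.NumberTheory.EllipticCurves.PeriodIndexCorestrictionLocal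
import HarnessLib

/-!
# Route `GenusKolyvaginAtTwo`, crux U_T `ShaCardDvdPowAtTwoRT` (stmt-BirchSwinnertonDyer-23658), LINE 19 `rational_pair_descent`,
# stub SANDWICH′ — ITS TWO INPUTS ON THE LIVE CONFIGURATION: the relaxed index (R′) `#res⁻¹(Ш(E/K)[2^∞]) ≤ #Ш(E/ℚ)[2^∞] · 2^{ord₂ c(Wd)}`
# and the anti-symmetrisation bound (A) `#(1 − τ_*) Ш(E/K)[2^∞] ≤ 2^{ord₂ c(Wd)}` (minimal twin)

Seat `bsd-line-gk2-p1` g19 (LEAD, cell `bsd-f1-sign2`), `--supports stmt-BirchSwinnertonDyer-23658` (helper; closes nothing).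
THEOREMS ONLY (no definition, no named fact, no `sorry`).  BSD is NOT proved by any of this; U_T is not proved here; the stub is closed in the
companion file `…RTSandwich.lean` (`stub_sandwichOfMinimalTwin` by name = `natCard_sha_dvd_two_mul_of_inputs` + (R′) + (A)).

THE MECHANISM OF (A) (memo `Lines/rational-pair-descent-lead-g19.md` §6c).  `X = Ш(E/K)[2^∞] ⊂ H¹(K, E_K)`, `τ_*` the action of the lift of
`σ ≠ 1`, `T = E^{(d_K)}` the twist, `ψ_* : H¹(K, T_K) ≃ H¹(K, E_K)` the twist isomorphism (`h1Equiv twistIso`): `ψ_*` maps `Ш ↔ Ш` and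
ANTI-commutes with `τ_*` (§1, the sign rule), so `(1 − τ_*)(ψ_* s) = ψ_*(s + τ'_* s) = ψ_*(res'(cor' s))` (`res' ∘ cor' = 1 + τ'_*`, tree
`resBaseChange_corBaseChange` for `T`).  Hence `(1 − τ_*)X` is the image under `ψ_* ∘ res'` of `C := cor'(ψ_*⁻¹ X) ⊂ H¹(ℚ, T)`, a finite group
of `2`-power-torsion classes whose restrictions lie in `Ш(T_K)` (`Ш` is `τ'_*`-stable, `SylvesterTwoShaConjugation.conjH1Points_mem_sha`); so
`C ⊂ res'⁻¹(Ш(T_K))`, `C ∩ Ш(T/ℚ) ⊂ Ш(T/ℚ)[2^∞] = 0` (gk2-p5 g29 `forall_primaryComponent_sha_twin_two_eq_zero_onHabitat`: `rank T(ℚ) = 1`,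
`#Sel₂(T) = 2`), and `#C = [C : C ∩ Ш(T/ℚ)] ≤ [res'⁻¹(Ш(T_K)) : Ш(T/ℚ) ∩ ·] ≤ 2^{ord₂ c(T)}` (gk2-p3 g18's twin genus budget
`relIndex_sha_comap_resBaseChange_twin_le_two_pow`, Kramer's local norm indices at `q ∣ d_K`).  (R′) is the W-side budget
`relIndex_sha_comap_resBaseChange_le_two_pow_padicValNat_tamagawaProduct_twin_of_Δ_neg` cut down to the `2`-primary preimage, with
`Ш(E/ℚ) ∩ res⁻¹(X) ⊂ Ш(E/ℚ)[2^∞]` (`ker res` is `2`-torsion) and `Ш(E/ℚ)[2^∞]` finite (g29 `finite_primaryComponent_sha_rat_two_onHabitat`).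

* §1 `h1Equiv_twistIso_conjH1Points` (**sign rule on `H¹(K, ·)`**: `ψ_*(τ_* s) = −τ_*(ψ_* s)`), `mem_localRestrictionKer_iff_h1Equiv_twistIso_mem`,
  `mem_sha_iff_h1Equiv_twistIso_mem` (`ψ_*` respects local kernels and `Ш`) — any `W/ℚ`, `K = ℚ(θ)`, `θ² = c`.
* §2 **`natCard_comap_resBaseChange_shaPrimary_le_onHabitat`** — (R′) on U_T's frame, any `ℚ`-model `Wd` of the twist.
* §3 **`natCard_map_sub_conjH1Points_shaPrimary_le_onHabitat`** — (A) on U_T's frame with `w(E) = 1` and `#Sel₂(Wd) = 2`.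

References: [Kramer1981] Thm. 1 and §2 Prop. 3; [GrossLMS1991] §5 (5.1)–(5.3); [SerreGaloisCohomology1997] I §2.4 Prop. 9, I §5.8;
[SilvermanAEC2009] X.§4, X.5 Cor. 5.4; [Dokchitser2013ParityNotes] §4.
-/

set_option autoImplicit false
-- the Theorems namespace of this sub repeats the summit name by design (D-0017 nested layout)
set_option linter.dupNamespace false

noncomputable section

open scoped Classical

universe u

namespace Summit.BirchSwinnertonDyer.BirchSwinnertonDyer.Theorems.GenusExact.PlusDescent

open Literature.NumberTheory.EllipticCurves Literature.NumberTheory.GaloisRepresentations WeierstrassCurve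
/-! ## §1 The twist isomorphism on `H¹(K, ·)`: sign rule and local / `Ш` compatibility -/

section TwistH1

variable (W : WeierstrassCurve ℚ) {K : Type u} [Field K] [CharZero K] {θ : K} {c : ℚ}
  (hθ : θ ∉ Set.range (algebraMap ℚ K)) (hc : θ ^ 2 = algebraMap ℚ K c)
  {C : VariableChange ℚ} (hC : C • W = W.quadraticTwist 1)

/-- **The sign rule on `H¹(K, ·)`.**  For `E = W/ℚ`, `K = ℚ(θ)`, `θ² = c`, the twist isomorphism `ψ : E^{(c)}_K(K̄) ≃ E_K(K̄)`
(`twistIso`) induces `ψ_* : H¹(K, E^{(c)}_K) ≃ H¹(K, E_K)` (`h1Equiv`), and for a lift `τ` of `σ ∈ Aut(K/ℚ)` with `σθ = −θ`: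
**`ψ_* (τ_* s) = −τ_* (ψ_* s)`** (`τ_*` = `IsLiftOfAut.conjH1Points`; on cocycles, `ψ(τ f(τ⁻¹gτ)) = −τ ψ(f(τ⁻¹gτ))` by the points-level
sign rule `twistIso_pointsMap_of_neg`).  Full-points twin of the tree's `conjAct_hPsiKT` / `h1Equiv_conjH1_neg`.
[cite: GrossLMS1991, §5 (5.1)] [cite: SilvermanAEC2009, X.5 Cor. 5.4] [cite: Dokchitser2013ParityNotes, §4] -/
theorem h1Equiv_twistIso_conjH1Points {σ : K ≃ₐ[ℚ] K} {τ : AlgebraicClosure K ≃+* AlgebraicClosure K}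
    (hτ : IsLiftOfAut σ τ) (hσ : σ θ = -θ) (s : ((W.quadraticTwist c).baseChange K).galH1) :
    h1Equiv (twistIso W hθ hc hC) (twistIso_smul W hθ hc hC) (hτ.conjH1Points (W.quadraticTwist c) s) =
      -(hτ.conjH1Points W (h1Equiv (twistIso W hθ hc hC) (twistIso_smul W hθ hc hC) s)) := by
  obtain ⟨f, rfl⟩ := oneCocycleClass_surjective _ s
  rw [h1Equiv_apply, h1Equiv_apply, IsLiftOfAut.conjH1Points, IsLiftOfAut.conjH1Points, resH1Hom_oneCocycleClass,
    resH1Hom_oneCocycleClass, resH1Hom_oneCocycleClass, resH1Hom_oneCocycleClass, ← oneCocycleClass_neg']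
  congr 1
  apply Subtype.ext
  ext g
  change twistIso W hθ hc hC (hτ.pointsMap (W.quadraticTwist c) (f.1 (hτ.conjGalCMH g))) =
    -(hτ.pointsMap W (twistIso W hθ hc hC (f.1 (hτ.conjGalCMH g))))
  exact twistIso_pointsMap_of_neg W hθ hc hC hτ hσ _

variable (E : Type u) [Field E] [Algebra K E]

/-- `ψ_*` respects the local kernels `ker(H¹(K, ·) → H¹(E, ·))` at every `K`-field `E` (`twistIso` is a composite of two changes of
variables over `K`; the local square `pointsMap_twistPointsIso`, then `mem_resKer_iff_h1Equiv_mem`). [cite: SilvermanAEC2009, X.§4] -/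
theorem mem_localRestrictionKer_iff_h1Equiv_twistIso_mem (s : ((W.quadraticTwist c).baseChange K).galH1) :
    s ∈ ((W.quadraticTwist c).baseChange K).localRestrictionKer E ↔
      h1Equiv (twistIso W hθ hc hC) (twistIso_smul W hθ hc hC) s ∈ (W.baseChange K).localRestrictionKer E := by
  have h₁ := twistUntwist_smul_baseChange W hθ hc
  have h₂ := map_smul_baseChange_eq_quadraticTwist_one W hC (K := K)
  refine mem_resKer_iff_h1Equiv_mem (resGal (K := K) E) (pointsMap _ E) (pointsMap_smul _ E) (pointsMap _ E)
    (pointsMap_smul _ E) (twistIso W hθ hc hC) (twistIso_smul W hθ hc hC)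
    ((twistLocalIso E h₁).trans (twistLocalIso E h₂).symm) (fun g Q ↦ ?_) (fun P ↦ ?_) s
  · rw [AddEquiv.trans_apply, AddEquiv.trans_apply, twistLocalIso_smul]
    exact symm_equivariant (twistLocalIso E h₂) (twistLocalIso_smul E h₂) g _
  · -- the local square for `twistIso = (twistPointsIso h₂)⁻¹ ∘ twistPointsIso h₁`
    rw [AddEquiv.trans_apply, AddEquiv.eq_symm_apply, ← pointsMap_twistPointsIso E h₂, ← pointsMap_twistPointsIso E h₁]
    change pointsMap _ E (twistPointsIso h₂ ((twistPointsIso h₂).symm (twistPointsIso h₁ P))) = _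
    rw [AddEquiv.apply_symm_apply]

end TwistH1

section TwistSha

open NumberField IsDedekindDomain

variable (W : WeierstrassCurve ℚ) {K : Type} [Field K] [NumberField K] {θ : K} {c : ℚ}
  (hθ : θ ∉ Set.range (algebraMap ℚ K)) (hc : θ ^ 2 = algebraMap ℚ K c)
  {C : VariableChange ℚ} (hC : C • W = W.quadraticTwist 1)

/-- **`ψ_*` maps `Ш(E^{(c)}_K/K)` onto `Ш(E_K/K)`** (place by place, `mem_localRestrictionKer_iff_h1Equiv_twistIso_mem`).
[cite: SilvermanAEC2009, X.§4 and X.5 Cor. 5.4] -/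
theorem mem_sha_iff_h1Equiv_twistIso_mem (s : ((W.quadraticTwist c).baseChange K).galH1) :
    s ∈ ((W.quadraticTwist c).baseChange K).sha ↔ h1Equiv (twistIso W hθ hc hC) (twistIso_smul W hθ hc hC) s ∈ (W.baseChange K).sha := by
  rw [mem_sha_iff, mem_sha_iff]
  exact and_congr (forall_congr' fun v ↦ mem_localRestrictionKer_iff_h1Equiv_twistIso_mem W hθ hc hC _ s)
    (forall_congr' fun w ↦ mem_localRestrictionKer_iff_h1Equiv_twistIso_mem W hθ hc hC _ s)

end TwistSha

/-! ## §2 (R′) and §3 (A) on U_T's frame -/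

section Habitat

open NumberField IsDedekindDomain Field Literature.NumberTheory.EllipticCurves.ModularForms AddSubgroup
open Summit.BirchSwinnertonDyer.BirchSwinnertonDyer.Theses.GenusKolyvaginAtTwo (KolyvaginRelationAtTwo)

variable (W : WeierstrassCurve ℚ) [W.IsElliptic] [W.IsGloballyMinimal] [NeZero (W.conductorNorm ℤ)]
variable (K : Type) [Field K] [NumberField K]

/-- **(R′) THE `2`-PRIMARY RELAXED INDEX: `#res⁻¹(Ш(E/K)[2^∞]) ≤ #Ш(E/ℚ)[2^∞] · 2^{ord₂ c(Wd)}`** on U_T's frame (rev-37 binders; only `hndiv`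
of the `M₀`-clause used), for ANY elliptic `ℚ`-model `Wd = Cd • E^{(d_K)}` of the twist: `R := res⁻¹(X)` lies in `res⁻¹(Ш(E_K))`, whose index over
`Ш(E/ℚ) ∩ ·` is `≤ 2^{ord₂ c(Wd)}` (gk2-p3's `Ш`-level genus budget); and `Ш(E/ℚ) ∩ R ⊂ Ш(E/ℚ)[2^∞]` (`2^k res b = 0 ⟹ 2^{k+1} b = 0`), a finite group.
[cite: Kramer1981, Thm. 1 and §2 Prop. 3] [cite: GrossLMS1991, §5 (5.3)] -/
theorem natCard_comap_resBaseChange_shaPrimary_le_onHabitat (hQ2 : KolyvaginRelationAtTwo) (hcm : ¬ W.HasCM)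
    (hT : Odd W.tamagawaProduct) (v : HeightOneSpectrum (𝓞 ℚ)) (h2v : ((2 : ℕ) : 𝓞 ℚ) ∉ v.asIdeal)
    (hNv : ((W.conductorNorm ℤ : ℕ) : 𝓞 ℚ) ∈ v.asIdeal) (hmult : W.HasMultiplicativeReductionAt v) (hneg : W.Δ < 0)
    (hIQ : IsImaginaryQuadratic K) (hodd : Odd (NumberField.discr K))
    (h3 : NumberField.discr K ≠ -3) (hHe : SatisfiesHeegnerHypothesis (W.conductorNorm ℤ) K)
    (hsq1 : ¬ IsSquare ((NumberField.discr K : ℚ) * -|W.Δ|)) (hsq2 : ¬ IsSquare ((NumberField.discr K : ℚ) * (-(2 * |W.Δ|))))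
    (hρ : ∀ n : ℕ, 0 < n → W.HasSurjectiveModNGaloisRep ((2 : ℤ) ^ n))
    (Dt : ModularParametrizationData W (W.conductorNorm ℤ)) (β : ℤ) (ι : K →+* ℂ) (d₁ : KolyvaginHeegnerData Dt β ι 1) (M₀ : ℕ)
    (hndiv : ¬ ∃ Q : (W.baseChange (ringClassField K ι 1)).toAffine.Point, ((2 ^ (M₀ + 1) : ℕ) : ℤ) • Q = d₁.derivedPoint)
    {Wd : WeierstrassCurve ℚ} [Wd.IsElliptic] (Cd : VariableChange ℚ) (hWd : Cd • W.quadraticTwist (NumberField.discr K : ℚ) = Wd) :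
    Nat.card (((AddCommGroup.primaryComponent (↥(W.baseChange K).sha) 2).map (W.baseChange K).sha.subtype).comap
        (resBaseChange W K)) ≤
      Nat.card (AddCommGroup.primaryComponent (↥W.sha) 2) * 2 ^ padicValNat 2 Wd.tamagawaProduct := by
  haveI : Fact (Nat.Prime 2) := ⟨Nat.prime_two⟩
  have h2 : Module.finrank ℚ K = 2 := hIQ.1
  obtain ⟨σ₀, -, hσ₀, -⟩ := exists_gal_ne_one_sqrt_discr K h2
  set R := ((AddCommGroup.primaryComponent (↥(W.baseChange K).sha) 2).map (W.baseChange K).sha.subtype).comap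
    (resBaseChange W K) with hR
  set Rf := ((W.baseChange K).sha).comap (resBaseChange W K) with hRf
  have hle : R ≤ Rf := AddSubgroup.comap_mono (AddSubgroup.map_subtype_le _)
  obtain ⟨hne, hbudget⟩ :=
    relIndex_sha_comap_resBaseChange_le_two_pow_padicValNat_tamagawaProduct_twin_of_Δ_neg W K hneg hIQ hodd hHe hT Cd hWd
  have hidx : (W.sha).relIndex R ≤ 2 ^ padicValNat 2 Wd.tamagawaProduct :=
    (AddSubgroup.relIndex_le_of_le_right hle hne).trans hbudget
  -- `Ш(E/ℚ) ∩ R ↪ Ш(E/ℚ)[2^∞]`, finite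
  haveI hYfin : Finite (AddCommGroup.primaryComponent (↥W.sha) 2) :=
    finite_primaryComponent_sha_rat_two_onHabitat hQ2 W hcm hT v h2v hNv hmult hneg K hIQ hodd h3 hHe hsq1 hsq2 hρ Dt β ι d₁ M₀ hndiv
  have hinter : Nat.card ((W.sha).addSubgroupOf R) ≤ Nat.card (AddCommGroup.primaryComponent (↥W.sha) 2) := by
    refine Nat.card_le_card_of_injective
      (fun b ↦ (⟨⟨((b : R) : W.galH1), AddSubgroup.mem_addSubgroupOf.mp b.2⟩, ?_⟩ : AddCommGroup.primaryComponent (↥W.sha) 2)) ?_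
    · obtain ⟨-, k, hk⟩ := (SelmerDescent.mem_comap_resBaseChange_shaPrimary_iff W ((b : R) : W.galH1)).mp (b : R).2
      have h2k : 2 ^ (k + 1) • ((b : R) : W.galH1) = 0 := by
        have hres0 : resBaseChange W K (2 ^ k • ((b : R) : W.galH1)) = 0 := by rw [map_nsmul, hk]
        have h := SelmerDescent.two_nsmul_eq_zero_of_resBaseChange_eq_zero W h2 hσ₀ hres0
        rwa [smul_smul, ← pow_succ'] at h
      exact (AddCommGroup.mem_primaryComponent).mpr
        ⟨k + 1, Subtype.ext (by rw [AddSubgroupClass.coe_nsmul, ZeroMemClass.coe_zero]; exact h2k)⟩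
    · intro b₁ b₂ h
      apply Subtype.ext
      apply Subtype.ext
      exact congrArg (fun z : AddCommGroup.primaryComponent (↥W.sha) 2 ↦ ((z : ↥W.sha) : W.galH1)) h
  -- `#R = [R : Ш ∩ R] · #(Ш ∩ R)`
  have hsplit : Nat.card ((W.sha).addSubgroupOf R) * (W.sha).relIndex R = Nat.card R := AddSubgroup.card_mul_index _
  calc Nat.card R = Nat.card ((W.sha).addSubgroupOf R) * (W.sha).relIndex R := hsplit.symm
    _ ≤ Nat.card (AddCommGroup.primaryComponent (↥W.sha) 2) * 2 ^ padicValNat 2 Wd.tamagawaProduct :=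
        Nat.mul_le_mul hinter hidx

/-- **(A) THE ANTI-SYMMETRISATION BOUND: `#(1 − τ_*) Ш(E/K)[2^∞] ≤ 2^{ord₂ c(Wd)}`** on U_T's frame with `W.rootNumber = 1`, `σ ≠ 1` in
`Aut(K/ℚ)` (chosen lift `liftAut σ`), for ANY elliptic `ℚ`-model `Wd = Cd • E^{(d_K)}` of the twist with `#Sel₂(Wd) = 2`: see the module
docstring (`(1 − τ_*)(ψ_* s) = ψ_*(res'(cor' s))` by the sign rule; `C = cor'(ψ_*⁻¹ X)` has `C ∩ Ш(T/ℚ) = 0` and index `≤ 2^{ord₂ c(T)} =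
2^{ord₂ c(Wd)}` in the twin's relaxed group).  [cite: Kramer1981, Thm. 1 and §2 Prop. 3] [cite: GrossLMS1991, §5 (5.1)–(5.3)]
[cite: SerreGaloisCohomology1997, I §2.4 Prop. 9] -/
theorem natCard_map_sub_conjH1Points_shaPrimary_le_onHabitat (hQ2 : KolyvaginRelationAtTwo) (hcm : ¬ W.HasCM)
    (hT : Odd W.tamagawaProduct) (v : HeightOneSpectrum (𝓞 ℚ)) (h2v : ((2 : ℕ) : 𝓞 ℚ) ∉ v.asIdeal)
    (hNv : ((W.conductorNorm ℤ : ℕ) : 𝓞 ℚ) ∈ v.asIdeal) (hmult : W.HasMultiplicativeReductionAt v) (hneg : W.Δ < 0)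
    (hIQ : IsImaginaryQuadratic K) (hodd : Odd (NumberField.discr K))
    (h3 : NumberField.discr K ≠ -3) (hHe : SatisfiesHeegnerHypothesis (W.conductorNorm ℤ) K)
    (hsq1 : ¬ IsSquare ((NumberField.discr K : ℚ) * -|W.Δ|)) (hsq2 : ¬ IsSquare ((NumberField.discr K : ℚ) * (-(2 * |W.Δ|))))
    (hρ : ∀ n : ℕ, 0 < n → W.HasSurjectiveModNGaloisRep ((2 : ℤ) ^ n))
    (Dt : ModularParametrizationData W (W.conductorNorm ℤ)) (β : ℤ) (ι : K →+* ℂ) (d₁ : KolyvaginHeegnerData Dt β ι 1)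
    (hy : ¬ IsOfFinAddOrder d₁.derivedPoint) (M₀ : ℕ)
    (hndiv : ¬ ∃ Q : (W.baseChange (ringClassField K ι 1)).toAffine.Point, ((2 ^ (M₀ + 1) : ℕ) : ℤ) • Q = d₁.derivedPoint)
    (hw : W.rootNumber = 1) {σ : K ≃ₐ[ℚ] K} (hσ1 : σ ≠ 1)
    {Wd : WeierstrassCurve ℚ} [Wd.IsElliptic] (Cd : VariableChange ℚ) (hWd : Cd • W.quadraticTwist (NumberField.discr K : ℚ) = Wd)
    (hSel : Nat.card (Wd.selmerGroup 2) = 2) :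
    Nat.card (((AddCommGroup.primaryComponent (↥(W.baseChange K).sha) 2).map (W.baseChange K).sha.subtype).map
        (AddMonoidHom.id (W.baseChange K).galH1 - (isLiftOfAut_liftAut σ).conjH1Points W)) ≤
      2 ^ padicValNat 2 Wd.tamagawaProduct := by
  haveI : Fact (Nat.Prime 2) := ⟨Nat.prime_two⟩
  have h2 : Module.finrank ℚ K = 2 := hIQ.1
  have hdK : (NumberField.discr K : ℚ) ≠ 0 := by exact_mod_cast NumberField.discr_ne_zero K
  obtain ⟨τ, θ₀, hτ1, hθ₀Q, hθ₀, hτθ₀, hall⟩ := exists_gal_ne_one_sqrt_discr K h2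
  obtain rfl : σ = τ := (hall σ).resolve_left hσ1
  obtain ⟨C, hC⟩ := W.exists_variableChange_quadraticTwist_one
  haveI hTell : (W.quadraticTwist (NumberField.discr K : ℚ)).IsElliptic := W.isElliptic_quadraticTwist hdK
  have hK : ∀ w : InfinitePlace K, w.IsComplex := hIQ.2.isComplex
  -- ### the objects
  set X : AddSubgroup ↥(W.baseChange K).sha := AddCommGroup.primaryComponent (↥(W.baseChange K).sha) 2 with hX
  set Xs : AddSubgroup (W.baseChange K).galH1 := X.map (W.baseChange K).sha.subtype with hXs
  set δ : (W.baseChange K).galH1 →+ (W.baseChange K).galH1 :=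
    AddMonoidHom.id (W.baseChange K).galH1 - (isLiftOfAut_liftAut σ).conjH1Points W with hδ
  set Φ := h1Equiv (twistIso W hθ₀Q hθ₀ hC) (twistIso_smul W hθ₀Q hθ₀ hC) with hΦ
  set cor' := corBaseChange K (W.quadraticTwist (NumberField.discr K : ℚ)) σ h2 hσ1 with hcor'
  set res' := resBaseChange (W.quadraticTwist (NumberField.discr K : ℚ)) K with hres'
  -- ### the key identity `(1 − τ_*)(ψ_* s) = ψ_*(res'(cor' s))`
  have hkey : ∀ s, δ (Φ s) = Φ (res' (cor' s)) := by
    intro s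
    rw [hres', hcor', resBaseChange_corBaseChange K (W.quadraticTwist (NumberField.discr K : ℚ)) σ h2 hσ1 (isLiftOfAut_liftAut σ) s,
      map_add, hΦ, h1Equiv_twistIso_conjH1Points W hθ₀Q hθ₀ hC (isLiftOfAut_liftAut σ) hτθ₀ s, hδ, AddMonoidHom.sub_apply,
      AddMonoidHom.id_apply, sub_eq_add_neg]
  -- ### `C := cor'(ψ_*⁻¹ Xs)`
  set π : (W.baseChange K).galH1 →+ (W.quadraticTwist (NumberField.discr K : ℚ)).galH1 :=
    cor'.comp Φ.symm.toAddMonoidHom with hπ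
  have hπapp : ∀ x, Φ (res' (π x)) = δ x := fun x ↦ by
    rw [hπ, AddMonoidHom.comp_apply, AddEquiv.coe_toAddMonoidHom, ← hkey, AddEquiv.apply_symm_apply]
  set Cg := Xs.map π with hCg
  -- ### finiteness
  haveI hXfin : Finite X :=
    finite_primaryComponent_sha_two_onHabitat hQ2 W hcm hT v h2v hNv hmult hneg K hIQ hodd h3 hHe hsq1 hsq2 hρ Dt β ι d₁ M₀ hndiv
  haveI hXsfin : Finite Xs := by
    have h : (Xs : Set (W.baseChange K).galH1).Finite := by
      rw [hXs, AddSubgroup.coe_map]; exact (Set.toFinite _).image _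
    exact h.to_subtype
  haveI hCfin : Finite Cg := by
    have h : (Cg : Set (W.quadraticTwist (NumberField.discr K : ℚ)).galH1).Finite := by
      rw [hCg, AddSubgroup.coe_map]; exact (Set.toFinite _).image _
    exact h.to_subtype
  -- ### `(1 − τ_*)Xs` is the image of `C` under `ψ_* ∘ res'`
  have hsurj : Nat.card (Xs.map δ) ≤ Nat.card Cg := by
    refine Nat.card_le_card_of_surjective (fun c : Cg ↦ (⟨Φ (res' (c : (W.quadraticTwist _).galH1)), ?_⟩ : Xs.map δ)) ?_
    · obtain ⟨x, hx, hxc⟩ := AddSubgroup.mem_map.mp c.2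
      rw [← hxc, hπapp]
      exact AddSubgroup.mem_map.mpr ⟨x, hx, rfl⟩
    · rintro ⟨y, hy'⟩
      obtain ⟨x, hx, rfl⟩ := AddSubgroup.mem_map.mp hy'
      exact ⟨⟨π x, AddSubgroup.mem_map.mpr ⟨x, hx, rfl⟩⟩, Subtype.ext (hπapp x)⟩
  -- ### `C ⊂ res'⁻¹(Ш(T_K))`
  have hCle : Cg ≤ ((W.quadraticTwist (NumberField.discr K : ℚ)).baseChange K).sha.comap res' := by
    rintro _ ⟨x, hx, rfl⟩
    have hxsha : x ∈ (W.baseChange K).sha := by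
      obtain ⟨x', -, rfl⟩ := AddSubgroup.mem_map.mp hx
      exact x'.2
    have hs : Φ.symm x ∈ ((W.quadraticTwist (NumberField.discr K : ℚ)).baseChange K).sha := by
      rw [mem_sha_iff_h1Equiv_twistIso_mem W hθ₀Q hθ₀ hC, ← hΦ, AddEquiv.apply_symm_apply]
      exact hxsha
    rw [AddSubgroup.mem_comap, hπ, AddMonoidHom.comp_apply, AddEquiv.coe_toAddMonoidHom, hres', hcor',
      resBaseChange_corBaseChange K _ σ h2 hσ1 (isLiftOfAut_liftAut σ)]
    exact AddSubgroup.add_mem _ hs (SylvesterTwoShaConjugation.conjH1Points_mem_sha _ hK (isLiftOfAut_liftAut σ) hs)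
  -- ### `Ш(T/ℚ)[2^∞] = 0` (the minimal twin) ⟹ `Ш(T/ℚ) ∩ C = 0`
  have hSelT : Nat.card ((W.quadraticTwist (NumberField.discr K : ℚ)).selmerGroup 2) = 2 := by
    rw [natCard_selmerGroup_eq_of_variableChange 2 hWd]; exact hSel
  have hShaT := forall_primaryComponent_sha_twin_two_eq_zero_onHabitat hQ2 W hcm hT v h2v hNv hmult hneg K hIQ hodd h3 hHe hsq1 hsq2
    hρ Dt β ι d₁ hy M₀ hndiv hw (W.quadraticTwist (NumberField.discr K : ℚ)) ⟨1, one_smul _ _⟩ hSelT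
  have hbot : ((W.quadraticTwist (NumberField.discr K : ℚ)).sha).addSubgroupOf Cg = ⊥ := by
    rw [eq_bot_iff]
    intro c hc
    rw [AddSubgroup.mem_addSubgroupOf] at hc
    rw [AddSubgroup.mem_bot]
    obtain ⟨x, hx, hxc⟩ := AddSubgroup.mem_map.mp c.2
    obtain ⟨x', hx', rfl⟩ := AddSubgroup.mem_map.mp hx
    obtain ⟨k, hk⟩ := (AddCommGroup.mem_primaryComponent).mp hx'
    have h0 : 2 ^ k • ((c : Cg) : (W.quadraticTwist (NumberField.discr K : ℚ)).galH1) = 0 := by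
      rw [← hxc, ← map_nsmul, AddSubgroup.coe_subtype, ← AddSubgroupClass.coe_nsmul, hk, ZeroMemClass.coe_zero, map_zero]
    have hmem : (⟨_, hc⟩ : ↥(W.quadraticTwist (NumberField.discr K : ℚ)).sha) ∈
        AddCommGroup.primaryComponent (↥(W.quadraticTwist (NumberField.discr K : ℚ)).sha) 2 :=
      (AddCommGroup.mem_primaryComponent).mpr ⟨k, Subtype.ext (by rw [AddSubgroupClass.coe_nsmul, ZeroMemClass.coe_zero]; exact h0)⟩
    exact Subtype.ext (by simpa using congrArg Subtype.val (hShaT _ hmem))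
  -- ### count in the twin's relaxed group
  obtain ⟨hne, hle⟩ := relIndex_sha_comap_resBaseChange_twin_le_two_pow W (K := K) hneg hIQ hodd hHe hT
    (Wd := W.quadraticTwist (NumberField.discr K : ℚ)) 1 (one_smul _ _)
  have hidx : ((W.quadraticTwist (NumberField.discr K : ℚ)).sha).relIndex Cg = Nat.card Cg := by
    change (((W.quadraticTwist (NumberField.discr K : ℚ)).sha).addSubgroupOf Cg).index = _
    rw [hbot, AddSubgroup.index_bot]
  have hCcard : Nat.card Cg ≤ 2 ^ padicValNat 2 (W.quadraticTwist (NumberField.discr K : ℚ)).tamagawaProduct := by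
    rw [← hidx]; exact (AddSubgroup.relIndex_le_of_le_right hCle hne).trans hle
  -- ### `ord₂ c(T) = ord₂ c(Wd)` (both equal the genus budget `Σ_{q ∣ d_K} i_q`)
  have heq : padicValNat 2 (W.quadraticTwist (NumberField.discr K : ℚ)).tamagawaProduct = padicValNat 2 Wd.tamagawaProduct := by
    have h1 := prod_ncard_roots_add_one_eq_two_pow_padicValNat_tamagawaProduct_twin W hIQ hodd hHe hT
      (Wd := W.quadraticTwist (NumberField.discr K : ℚ)) 1 (one_smul _ _)
    have h2' := prod_ncard_roots_add_one_eq_two_pow_padicValNat_tamagawaProduct_twin W hIQ hodd hHe hT Cd hWd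
    exact Nat.pow_right_injective le_rfl (h1.symm.trans h2')
  calc Nat.card (Xs.map δ) ≤ Nat.card Cg := hsurj
    _ ≤ 2 ^ padicValNat 2 (W.quadraticTwist (NumberField.discr K : ℚ)).tamagawaProduct := hCcard
    _ = 2 ^ padicValNat 2 Wd.tamagawaProduct := by rw [heq]

end Habitat

end Summit.BirchSwinnertonDyer.BirchSwinnertonDyer.Theorems.GenusExact.PlusDescent

end
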